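import Mathlib
import Literature.NumberTheory.EllipticCurves.Newforms
import Literature.Barriers.RiemannHypothesis.DavenportHeilbronnDegreeTwo
import HarnessLib

/-!
# Balkanova–Frolenkov, *Moments of `L`-functions and the Liouville–Green method* (JEMS 23 (2021);
# arXiv:1610.03465), §1 and §8: non-vanishing of central values `L_f(1/2)` for primitive forms of
# level `1` in the weight aspect — `1/5 − ε` for an individual weight (Theorems 1.1 = 8.10, 8.7),
# `1/2 − ε` on average over the weight (Theorem 8.8, and (1.1) = Iwaniec–Sarnak 2000), with the
# mollified moments of §8 (Lemmas 8.1–8.6: mollifier length `M = k^Δ`, proportion `Δ/(1+Δ)`)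

Topic `Literature/NumberTheory/LFunctions` (namespace `Literature.NumberTheory.LFunctions`; the
paper's objects live in the sub-namespace `LevelOneCentralValues`). STATEMENT LAYER (D-0014): named
facts (`def … : Prop`, status theorem-in-print) over honest definitions of the family
`H_{k}(1)` (normalised Hecke eigen cusp forms of level `1` and weight `k`), the analytically
normalised central value `L_f(1/2)`, the Petersson norm and the harmonic weight `ω_f`, and the
Kowalski–Michel–VanderKam-type mollifier of §8.1. VOCABULARY REUSED, NOT RE-DECLARED: Mathlib's
level-one cusp forms `CuspForm 𝒮ℒ k` and `q`-expansions `UpperHalfPlane.qExpansion 1`; the tree's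
`Literature.NumberTheory.EllipticCurves.ModularForms.IsHeckeEigenform` / `IsNormalized` (Hecke
operators `T_p`, file `EllipticCurves/Newforms.lean`) and `Literature.Barriers.RiemannHypothesis.cuspFormLambda`
(`Λ_f(s) = ∫_0^∞ f(iy) y^{s−1} dy`, absolutely convergent for every `s` for a cusp form; file
`Barriers/RiemannHypothesis/DavenportHeilbronnDegreeTwo.lean`). Typed for the Landau–Siegel
programme (rung F-S3, §C harvest rows T-022/T-023; §B-fam START-HERE): the weight-aspect form of the
THIRD knife edge of record — proportion exactly `1/2` on average (mollifier `k^Δ`, `Δ < 1`, giving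
`Δ/(1+Δ)`), `1/5` for a single weight (`Δ < 1/4`) — with the source's own sentence "the non-existence
of Landau–Siegel zeros for Dirichlet `L`-functions of real primitive characters would follow if (1.1)
is established with proportion strictly larger than `1/2`" recorded, NOT asserted. Nothing here is a
claim about Landau–Siegel zeros.

## What the source prints (held text `paper:arxiv-1610.03465`, corpus-tex chunks p0003–p0004,
## p0017, p0019–p0022, read 2026-08-26)

O. Balkanova, D. Frolenkov, *Moments of `L`-functions and the Liouville–Green method*, J. Eur. Math.
Soc. **23** (2021) 1333–1380 = arXiv:1610.03465 [BalkanovaFrolenkov2021].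

§1 (p0003): "Let `H_{2k}(1)` be the space of primitive forms of level `1` and weight `2k ≥ 12`,
`k ∈ ℕ`. For `f ∈ H_{2k}(1)`, let `L_f(1/2)` be the associated `L`-function at the critical point.
For any `ε > 0` one has
`lim_{K→∞} (1/K) Σ_{k ≤ K} #{f ∈ H_{4k}(1), L_f(1/2) ≥ 1/(log k)²} / #{f ∈ H_{4k}(1)} ≥ 1/2 − ε` (1.1).
Moreover, the non-existence of Landau–Siegel zeros for Dirichlet `L`-functions of real primitive
characters would follow if (1.1) is established with proportion strictly larger than `1/2`.
Inequality (1.1) was proved by Iwaniec and Sarnak [IS] in 2000."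

> **Theorem 1.1** (p0003:L21–26; = **Theorem 8.10**, p0021). For any `ε > 0` there exists
> `k₀ = k₀(ε)` such that for any `k ≥ k₀` and `k ≡ 0 (mod 2)` we have
> `(1/|H_{2k}(1)|) Σ_{f ∈ H_{2k}(1), L_f(1/2) ≥ (log k)^{−2}} 1 ≥ 1/5 − ε` (1.2).

§2 (p0004:L36–92): "Every `f ∈ H_{2k}(1)` has a Fourier expansion of the form
`f(z) = Σ_{n≥1} λ_f(n) n^{(2k−1)/2} e(nz)` (2.6) … `L_f(s) = Σ_{n≥1} λ_f(n) n^{−s}`, `Re s > 1` (2.8) …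
The completed `L`-function `Λ_f(s) = (1/2π)^s Γ(s + (2k−1)/2) L_f(s)` (2.10) satisfies the functional
equation `Λ_f(s) = ε_f Λ_f(1−s)`, `ε_f = i^{2k}` (2.11) and can be analytically continued on the whole
complex plane. It follows from equation (2.11) that `L_f(1/2) = 0` for odd `k`. The harmonic weight is
defined by `ω_f = Γ(2k−1)/((4π)^{2k−1} ⟨f,f⟩₁) = 12ζ(2)/((2k−1) L(sym² f,1))` (2.12), where
`⟨f,f⟩₁` is the Petersson inner product on the space of level `1` holomorphic modular forms. Then the
harmonic summation can be written as `Σ^h_{f ∈ H_{2k}(1)} α_f := Σ_{f ∈ H_{2k}(1)} ω_f α_f` (2.13)."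

§7 (p0017:L1–12): "we estimate the error terms averaged over `k` with a test function
`h ∈ C_0^∞(ℝ⁺)`, which is non-negative, compactly supported on interval `[θ₁,θ₂]` such that
`θ₂ > θ₁ > 0` and `‖h^{(n)}‖₁ ≪ 1` for all `n ≥ 0` (7.1). Let `H := ∫_0^∞ h(y) dy` (7.2)."

§8.1 (p0019:L1–20): "We choose a mollifier of type (see [IS, KMV]) `M(f) = Σ_{m ≤ M} x_m λ_f(m) m^{−1/2}`
(8.1), where `x_m = (μ(m)/ρ(m)) P(log(M/m)/log M)` (8.2), `ρ(m) = ∏_{p∣m}(1 + 1/p)`, `P(x) = x²` (8.3)."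

> **Lemma 8.1** (p0019:L27–33). Let `k ≡ 0 (mod 2)`, `M = k^Δ`. For any `ε > 0` there is
> `k₀ = k₀(ε)` such that for every `k ≥ k₀` the inequality `Σ^h_{f ∈ H_{2k}(1)} M²(f) ≪ log M` (8.5)
> holds for any `Δ < 1 − ε`.
> **Lemma 8.2** (p0019:L58–64). Let `M = K^Δ`. For any `ε > 0` there is `K₀ = K₀(ε)` such that for
> every `K ≥ K₀` the inequality `Σ_k h(4k/K) Σ^h_{f ∈ H_{4k}(1)} M²(f) ≪ K log M` holds for any
> `Δ < 1 − ε`.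
> **Lemma 8.3** (p0019:L68–75). Let `k ≡ 0 (mod 2)` and `M = k^Δ`. For any `ε > 0` there is `k₀ = k₀(ε)`
> such that for every `k ≥ k₀` one has `M₁ := Σ^h_{f ∈ H_{2k}(1)} M(f) L_f(1/2) = 4ζ(2)/log M + O((log M)^{−2})`
> for any `Δ < 1 − ε`.
> **Lemma 8.4** (p0019:L142–148). Let `M = K^Δ`. For any `ε > 0` there is `K₀ = K₀(ε)` such that for
> every `K ≥ K₀` one has `A₁ := Σ_k h(4k/K) Σ^h_{f ∈ H_{4k}(1)} M(f) L_f(1/2) = (HK/4)·4ζ(2)/log M + O(K (log M)^{−2})`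
> for any `Δ < 1 − ε`.
> **Lemma 8.5** (p0019:L162–169). Let `k ≡ 0 (mod 2)` and `M = k^Δ`. For any `ε > 0` there is `k₀ = k₀(ε)`
> such that for every `k ≥ k₀` one has
> `M₂ := Σ^h_{f ∈ H_{2k}(1)} M²(f) L_f²(1/2) = (16ζ²(2)/(log M)²)(1 + 1/Δ) + O((log M)^{−3})`
> for any `Δ < 1/4 − ε`.
> **Lemma 8.6** (p0021:L1–9). Let `M = K^Δ`. For any `ε > 0` there is `K₀ = K₀(ε)` such that for every
> `K ≥ K₀` one has `A₂ := Σ_k h(4k/K) Σ^h_{f ∈ H_{4k}(1)} M²(f) L_f²(1/2) = (HK/4)(16ζ²(2)/(log M)²)(1 + 1/Δ) + O(K (log M)^{−3})`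
> for any `Δ < 1 − ε`.
> **Theorem 8.7** (p0021:L31–36). For any `ε > 0` there exists `k₀ = k₀(ε)` such that for any `k ≥ k₀`
> and `k ≡ 0 (mod 2)` we have `Σ^h_{f ∈ H_{2k}(1), L_f(1/2) ≥ (log k)^{−2}} 1 ≥ 1/5 − ε`.
> [Proof: "the largest admissible length of mollifier is `Δ < 1/4 − ε` …
> `≥ (M₁ − M̃₁)²/M₂ ≥ Δ/(1+Δ)` for any `Δ < 1/4 − ε`."]
> **Theorem 8.8** (p0021:L59–65). For any `ε > 0` there is `K₀ = K₀(ε)` such that for any `K ≥ K₀` we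
> have `(4/(HK)) Σ_k h(4k/K) Σ^h_{f ∈ H_{4k}(1), L_f(1/2) ≥ (log k)^{−2}} 1 ≥ 1/2 − ε`.
> [Proof: "… `≥ Δ/(1+Δ)` for any `Δ < 1 − ε`."]
> **Theorem 8.10** (p0021:L139–p0022) = Theorem 1.1 (natural average, via Lemma 8.9 [KM] and
> "`|H_{2k}(1)| = (2k−1)/12 + O(1)`").

## Lean rendering / design choices

* LEVEL ONE. `S_k(SL₂(ℤ))` is Mathlib's `CuspForm 𝒮ℒ k` (`𝒮ℒ` = `SL(2,ℤ)` inside `GL(2,ℝ)`). "Primitive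
  form of level `1`" = normalised (`a_1 = 1`) Hecke eigenform: `primitiveForms k` is the SET of
  `f : CuspForm 𝒮ℒ k` with the tree's `IsNormalized f ∧ IsHeckeEigenform f`. It is finite (a basis of
  `S_k`), so `Set.ncard` and `finsum` over it are the printed `#`/`Σ`; no `Fintype` instance is
  declared (typer lint: no instances).
* NORMALISATIONS. `λ_f(n) = a_f(n)/n^{(k−1)/2}` for weight `k` ((2.6) with `2k ↦ k`; `heckeLambda`).
  `L_f(1/2)`: by (2.8)–(2.10) and the Mellin formula `Λ^{Mel}_f(s) := ∫_0^∞ f(iy) y^{s−1} dy =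
  (2π)^{−s} Γ(s) Σ a_f(n) n^{−s} = (2π)^{−s} Γ(s) L_f(s − (k−1)/2)` (absolutely convergent Mellin
  integral for every `s`, = the continuation), the central point `s = 1/2` of `L_f` is `s = k/2` of
  `Λ^{Mel}_f`, and `L_f(1/2) = (2π)^{k/2} Γ(k/2)^{−1} · Λ^{Mel}_f(k/2)` (`centralValue`, built on the
  tree's `cuspFormLambda`). For `f ∈ H_k(1)` this is a real number (`λ_f` real); "`L_f(1/2) ≥ c`" is
  typed on the real part, `c ≤ (centralValue f).re`.
* PETERSSON / HARMONIC WEIGHT. Mathlib has no Petersson inner product; `⟨f,f⟩₁ = ∫_{SL₂(ℤ)\ℍ} |f|² yᵏ dxdy/y²`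
  is written as the iterated real integral over the standard fundamental domain
  `{|x| ≤ 1/2, y ≥ √(1−x²)}` (its boundary is null): `peterssonNormSq f = ∫_{−1/2}^{1/2} ∫_{√(1−x²)}^∞
  ‖f(x+iy)‖² y^{k−2} dy dx` (un-normalised, as the Petersson formula (2.14)/Thm 2.1 with leading term
  `δ_{l,n}` requires); `ω_f = Γ(k−1)/((4π)^{k−1}⟨f,f⟩₁)` (`harmonicWeight`, (2.12) with `2k ↦ k`);
  `Σ^h_{f} α_f = Σ_{f ∈ H_k(1)} ω_f α_f` (`harmonicSum`).
* §8 MOLLIFIER verbatim: `x_m = μ(m)/ρ(m) · (log(M/m)/log M)²` for `m ≤ M` (`mollifierCoeff`),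
  `M(f) = Σ_{m ≤ M} x_m λ_f(m) m^{−1/2}` (`mollifierValue`). `ζ(2) = π²/6` (`zetaTwo`).
* WEIGHT AVERAGES. `h ∈ C_0^∞(ℝ⁺)`, `h ≥ 0`, `tsupport h ⊆ [θ₁,θ₂]`, `0 < θ₁` (`IsWeightTest`; for such `h`
  every `‖h^{(n)}‖₁` is finite, which is all "`≪ 1`" asks of a FIXED `h`); `H = ∫ h`; `Σ_k h(4k/K)(…)`
  is a `finsum` over `k : ℕ` (finitely many `k ≍ K` contribute; `k = 0` gives `h(0) = 0`).
  ERRATUM 2026-08-27: `IsWeightTest` admits `h ≡ 0` (empty `tsupport`), for which `H = 0`; the printed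
  Theorem 8.8 divides by `H` ((7.2), `4/(HK)` in its display), so its faithful rendering carries the
  printed implicit hypothesis `0 < H` — `balkanovaFrolenkov2021_theorem88'`; the original rendering
  `balkanovaFrolenkov2021_theorem88` is false as typed (kernel: `not_balkanovaFrolenkov2021_theorem88`,
  file `LevelOneCentralValuesWeightAspectRefutation.lean`) and is kept byte-identical, flagged.
* ASYMPTOTICS. "For any `ε > 0` there is `k₀(ε)` … for any `Δ < 1 − ε`": typed with `∃ k₀ C` AFTER
  `ε, Δ` (and `h`) — constants may depend on `Δ` (the source leaves the `O`-constant's dependence on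
  `Δ` implicit; this reading is never stronger than print), `0 < Δ` explicit (`M = k^Δ > 1` is needed
  for `log M` in denominators). Theorems 1.1/8.7/8.8/(1.1): `∀ ε > 0, ∃ k₀/K₀, ∀ k ≥ k₀ …` verbatim,
  with "`(1/|H|)·# ≥ 1/5 − ε`" cleared of the denominator (`(1/5 − ε)·|H| ≤ #`) and (1.1)'s
  `lim_{K} (1/K)Σ_{k≤K} r_k ≥ 1/2 − ε` for every `ε` read as `∀ ε, ∃ K₀, ∀ K ≥ K₀, (1/K)Σ_{k≤K} r_k ≥ 1/2 − ε`
  (the `lim inf` reading; the displayed `lim` need not exist).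
* No instances, no notation; imports Mathlib + the two tree files named above.

## Deliberately not here

* §§3–7 (exact formulas for the twisted first/second moments via `₁F₁`, `₂F₁` and their
  Liouville–Green approximations; Theorems 3.1–7.5) — the §B-fam E(d) inputs proper; a separate file
  if B-fam asks (T-021-type rows). Lemma 8.9 (harmonic → natural, [KM]).
* The sentence "> 1/2 in (1.1) would exclude Landau–Siegel zeros" is Iwaniec–Sarnak's theorem
  (IwaniecSarnak2000; typed from Iwaniec LNM 1891 §7 by the §C typer-4 seat) — recorded, not typed here.

References: [cite: BalkanovaFrolenkov2021, §1 Thm 1.1 and (1.1); §2 (2.6)–(2.13); §7 (7.1)–(7.2);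
§8 Lemmas 8.1–8.6, Thms 8.7, 8.8, 8.10]; [cite: IwaniecSarnak2000] for (1.1) (attribution printed in
[BalkanovaFrolenkov2021, §1]).

«The programme SEARCHES and TYPES; no claim about Landau–Siegel zeros, Theorems 1–2 of
arXiv:2211.02515 or a repaired Margin232 until a kernel theorem says so.»
-/

noncomputable section

open scoped Classical ContDiff MatrixGroups
open Complex Filter MeasureTheory UpperHalfPlane
open Literature.NumberTheory.EllipticCurves.ModularForms (IsHeckeEigenform IsNormalized)
open Literature.Barriers.RiemannHypothesis (cuspFormLambda)

namespace Literature.NumberTheory.LFunctions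

namespace LevelOneCentralValues

/-! ### The family `H_k(1)` and the normalisations -/

/-- `H_k(1)`: the primitive forms of level `1` and weight `k` = the normalised (`a_1(f) = 1`) Hecke
eigen cusp forms in `S_k(SL₂(ℤ))` (tree predicates `IsNormalized`, `IsHeckeEigenform`). A finite set
(the Hecke basis of `S_k`). [cite: BalkanovaFrolenkov2021, §2 (before (2.6))] -/
def primitiveForms (k : ℤ) : Set (CuspForm 𝒮ℒ k) :=
  {f | IsNormalized f ∧ IsHeckeEigenform f}

/-- The normalised Hecke eigenvalue `λ_f(n) = a_f(n) / n^{(k−1)/2}` of a weight-`k` form, where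
`f(z) = Σ_{n ≥ 1} a_f(n) e(nz) = Σ λ_f(n) n^{(k−1)/2} e(nz)` ((2.6), printed for weight `2k`).
[cite: BalkanovaFrolenkov2021, §2 (2.6)] -/
def heckeLambda {k : ℤ} (f : CuspForm 𝒮ℒ k) (n : ℕ) : ℂ :=
  (qExpansion 1 f).coeff n / (((n : ℝ) ^ (((k : ℝ) - 1) / 2) : ℝ) : ℂ)

/-- The analytically normalised central value `L_f(1/2)` of a weight-`k` level-one cusp form:
`L_f(1/2) = (2π)^{k/2} Γ(k/2)^{−1} · Λ^{Mel}_f(k/2)`, where `Λ^{Mel}_f(s) = ∫_0^∞ f(iy) y^{s−1} dy =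
(2π)^{−s} Γ(s) L_f(s − (k−1)/2)` is the tree's `cuspFormLambda` (absolutely convergent for every `s`,
hence the analytic continuation of (2.8) via (2.10)). [cite: BalkanovaFrolenkov2021, §2 (2.8)–(2.11)] -/
def centralValue {k : ℤ} (f : CuspForm 𝒮ℒ k) : ℂ :=
  (((2 * Real.pi) ^ ((k : ℝ) / 2) / Real.Gamma ((k : ℝ) / 2) : ℝ) : ℂ) *
    cuspFormLambda f ((k : ℂ) / 2)

/-- The (un-normalised) Petersson norm `⟨f,f⟩₁ = ∫_{SL₂(ℤ)\ℍ} |f(z)|² yᵏ dx dy / y²`, as the iterated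
integral over the standard fundamental domain `|x| ≤ 1/2`, `y ≥ √(1 − x²)`:
`∫_{−1/2}^{1/2} ∫_{√(1−x²)}^{∞} ‖f(x+iy)‖² y^{k−2} dy dx`. [cite: BalkanovaFrolenkov2021, §2 (2.12)] -/
def peterssonNormSq {k : ℤ} (f : CuspForm 𝒮ℒ k) : ℝ :=
  ∫ x in Set.Icc (-(1 / 2 : ℝ)) (1 / 2),
    ∫ y in Set.Ioi (Real.sqrt (1 - x ^ 2)),
      ‖f (ofComplex ((x : ℂ) + (y : ℂ) * Complex.I))‖ ^ 2 * y ^ ((k : ℝ) - 2)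

/-- The harmonic weight `ω_f = Γ(k−1) / ((4π)^{k−1} ⟨f,f⟩₁)` of a weight-`k` form ((2.12), printed for
weight `2k`: `Γ(2k−1)/((4π)^{2k−1}⟨f,f⟩₁) = 12ζ(2)/((2k−1)L(sym²f,1))`).
[cite: BalkanovaFrolenkov2021, §2 (2.12)] -/
def harmonicWeight {k : ℤ} (f : CuspForm 𝒮ℒ k) : ℝ :=
  Real.Gamma ((k : ℝ) - 1) / ((4 * Real.pi) ^ ((k : ℝ) - 1) * peterssonNormSq f)

/-- The harmonic sum `Σ^h_{f ∈ H_k(1)} α_f := Σ_{f ∈ H_k(1)} ω_f α_f` (2.13) (a `finsum` over the finite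
set `primitiveForms k`). [cite: BalkanovaFrolenkov2021, §2 (2.13)] -/
def harmonicSum (k : ℤ) (α : CuspForm 𝒮ℒ k → ℂ) : ℂ :=
  ∑ᶠ f ∈ primitiveForms k, (harmonicWeight f : ℂ) * α f

/-- The forms of `H_k(1)` with central value at least `c`: `{f ∈ H_k(1) : L_f(1/2) ≥ c}` (central
values of primitive forms are real; the comparison is on the real part).
[cite: BalkanovaFrolenkov2021, §1 (1.1)–(1.2)] -/
def largeValueForms (k : ℤ) (c : ℝ) : Set (CuspForm 𝒮ℒ k) :=
  {f | f ∈ primitiveForms k ∧ c ≤ (centralValue f).re}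

/-- `largeValueForms k c ⊆ H_k(1)`. [cite: BalkanovaFrolenkov2021, §1 (1.2)] -/
theorem largeValueForms_subset (k : ℤ) (c : ℝ) : largeValueForms k c ⊆ primitiveForms k :=
  fun _ hf => hf.1

/-- `ζ(2) = π²/6`, the constant in the main terms of Lemmas 8.3–8.6.
[cite: BalkanovaFrolenkov2021, Lemma 8.3 (4ζ(2)/log M)] -/
def zetaTwo : ℝ :=
  Real.pi ^ 2 / 6

/-! ### The mollifier of §8.1 -/

/-- `ρ(m) = ∏_{p ∣ m} (1 + 1/p)` (8.3). [cite: BalkanovaFrolenkov2021, §8.1 (8.3)] -/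
def rhoFactor (m : ℕ) : ℝ :=
  ∏ p ∈ m.primeFactors, (1 + 1 / (p : ℝ))

/-- The mollifier coefficients (8.2)–(8.3) with `P(x) = x²`:
`x_m = (μ(m)/ρ(m)) · (log(M/m)/log M)²` for `1 ≤ m ≤ M`, and `0` otherwise.
[cite: BalkanovaFrolenkov2021, §8.1 (8.2)–(8.3)] -/
def mollifierCoeff (M : ℝ) (m : ℕ) : ℝ :=
  if 1 ≤ m ∧ (m : ℝ) ≤ M then
    (ArithmeticFunction.moebius m : ℝ) / rhoFactor m * (Real.log (M / m) / Real.log M) ^ 2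
  else 0

/-- The mollifier `M(f) = Σ_{m ≤ M} x_m λ_f(m) m^{−1/2}` (8.1) of length `M`.
[cite: BalkanovaFrolenkov2021, §8.1 (8.1)] -/
def mollifierValue {k : ℤ} (M : ℝ) (f : CuspForm 𝒮ℒ k) : ℂ :=
  ∑ m ∈ Finset.Icc 1 ⌊M⌋₊,
    ((mollifierCoeff M m / Real.sqrt m : ℝ) : ℂ) * heckeLambda f m

/-! ### Weight-average test functions (§7) -/

/-- The §7 test functions: `h ∈ C_0^∞(ℝ⁺)`, non-negative, compactly supported on `[θ₁, θ₂]` with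
`0 < θ₁ < θ₂` ((7.1); for a fixed such `h` all the norms `‖h^{(n)}‖₁` are finite).
[cite: BalkanovaFrolenkov2021, §7 (7.1)] -/
def IsWeightTest (h : ℝ → ℝ) : Prop :=
  ContDiff ℝ ∞ h ∧ (∀ y, 0 ≤ h y) ∧ ∃ θ₁ θ₂ : ℝ, 0 < θ₁ ∧ θ₁ < θ₂ ∧ tsupport h ⊆ Set.Icc θ₁ θ₂

/-- `H = ∫_0^∞ h(y) dy` (7.2) (`= ∫_ℝ h` for `h` supported in `(0,∞)`).
[cite: BalkanovaFrolenkov2021, §7 (7.2)] -/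
def weightMass (h : ℝ → ℝ) : ℝ :=
  ∫ y, h y

/-- The smooth weight average `Σ_k h(4k/K) · a(k)` over the weights `4k` (as in `A₁`, `A₂`, Lemma 8.2,
Theorem 8.8); a `finsum` over `k : ℕ`, finite for compactly supported `h`.
[cite: BalkanovaFrolenkov2021, §7 (7.3)–(7.4)] -/
def weightAverage (h : ℝ → ℝ) (K : ℝ) (a : ℕ → ℂ) : ℂ :=
  ∑ᶠ k : ℕ, (h (4 * (k : ℝ) / K) : ℂ) * a k

/-! ### §1: the natural-average non-vanishing theorems -/

/-- **Balkanova–Frolenkov 2021, Theorem 1.1 (= Theorem 8.10)** (individual weight, natural count).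
For any `ε > 0` there exists `k₀ = k₀(ε)` such that for any `k ≥ k₀` with `k ≡ 0 (mod 2)`:
`(1/|H_{2k}(1)|) · #{f ∈ H_{2k}(1) : L_f(1/2) ≥ (log k)^{−2}} ≥ 1/5 − ε` — typed with the denominator
cleared. (Mollifier length `k^Δ`, `Δ < 1/4`; `1/5 = Δ/(1+Δ)` at `Δ = 1/4`.) Status: theorem-in-print
(named fact, not proved here). [cite: BalkanovaFrolenkov2021, Theorem 1.1 (1.2) = Theorem 8.10] -/
def balkanovaFrolenkov2021_theorem11 : Prop :=
  ∀ ε : ℝ, 0 < ε → ∃ k₀ : ℕ, ∀ k : ℕ, k₀ ≤ k → Even k →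
    (1 / 5 - ε) * (Set.ncard (primitiveForms (2 * (k : ℤ))) : ℝ) ≤
      (Set.ncard (largeValueForms (2 * (k : ℤ)) (1 / Real.log k ^ 2)) : ℝ)

/-- The natural proportion `r_k = #{f ∈ H_{4k}(1) : L_f(1/2) ≥ (log k)^{−2}} / #H_{4k}(1)` appearing
in (1.1) (`= 0` when `H_{4k}(1)` is empty, i.e. `4k < 12`). [cite: BalkanovaFrolenkov2021, §1 (1.1)] -/
def weightFourProportion (k : ℕ) : ℝ :=
  (Set.ncard (largeValueForms (4 * (k : ℤ)) (1 / Real.log k ^ 2)) : ℝ) /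
    (Set.ncard (primitiveForms (4 * (k : ℤ))) : ℝ)

/-- **(1.1) — Iwaniec–Sarnak 2000 in the weight aspect, as printed by Balkanova–Frolenkov §1.** For
any `ε > 0`, `lim_{K→∞} (1/K) Σ_{k ≤ K} #{f ∈ H_{4k}(1) : L_f(1/2) ≥ (log k)^{−2}} / #H_{4k}(1) ≥ 1/2 − ε`
— typed in the `lim inf` reading: for every `ε > 0` there is `K₀` with
`(1/K) Σ_{k=1}^{K} r_k ≥ 1/2 − ε` for all `K ≥ K₀`. "Inequality (1.1) was proved by Iwaniec and Sarnak
[IS] in 2000"; Balkanova–Frolenkov reprove its harmonic smooth form (Theorem 8.8). The source adds: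
"the non-existence of Landau–Siegel zeros for Dirichlet `L`-functions of real primitive characters
would follow if (1.1) is established with proportion strictly larger than `1/2`" (recorded, not typed).
Status: theorem-in-print (named fact). [cite: BalkanovaFrolenkov2021, §1 (1.1)]
[cite: IwaniecSarnak2000, main theorem (weight aspect), as restated in BalkanovaFrolenkov2021 (1.1)] -/
def iwaniecSarnak2000_weightAspect_eq11 : Prop :=
  ∀ ε : ℝ, 0 < ε → ∃ K₀ : ℕ, ∀ K : ℕ, K₀ ≤ K →
    1 / 2 - ε ≤ (∑ k ∈ Finset.Icc 1 K, weightFourProportion k) / (K : ℝ)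

/-! ### §8: mollified moments (Lemmas 8.1–8.6) and the harmonic non-vanishing theorems -/

/-- **Lemma 8.1** (second moment of the mollifier alone, individual even `k`, `M = k^Δ`,
`0 < Δ < 1 − ε`): `Σ^h_{f ∈ H_{2k}(1)} M²(f) ≪ log M` for `k ≥ k₀`. Typed: constants `k₀, C` after
`ε, Δ`. Status: theorem-in-print (named fact). [cite: BalkanovaFrolenkov2021, Lemma 8.1 (8.5)] -/
def balkanovaFrolenkov2021_lemma81 : Prop :=
  ∀ ε Δ : ℝ, 0 < ε → 0 < Δ → Δ < 1 - ε →
    ∃ k₀ : ℕ, ∃ C : ℝ, ∀ k : ℕ, k₀ ≤ k → Even k →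
      ‖harmonicSum (2 * (k : ℤ)) (fun f => mollifierValue ((k : ℝ) ^ Δ) f ^ 2)‖ ≤
        C * Real.log ((k : ℝ) ^ Δ)

/-- **Lemma 8.2** (the same on average over the weights `4k ≍ K` with a §7 test function `h`,
`M = K^Δ`, `0 < Δ < 1 − ε`): `Σ_k h(4k/K) Σ^h_{f ∈ H_{4k}(1)} M²(f) ≪ K log M` for `K ≥ K₀`. Status:
theorem-in-print (named fact). [cite: BalkanovaFrolenkov2021, Lemma 8.2] -/
def balkanovaFrolenkov2021_lemma82 : Prop :=
  ∀ h : ℝ → ℝ, IsWeightTest h → ∀ ε Δ : ℝ, 0 < ε → 0 < Δ → Δ < 1 - ε →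
    ∃ K₀ C : ℝ, ∀ K : ℝ, K₀ ≤ K →
      ‖weightAverage h K (fun k =>
          harmonicSum (4 * (k : ℤ)) (fun f => mollifierValue (K ^ Δ) f ^ 2))‖ ≤
        C * K * Real.log (K ^ Δ)

/-- **Lemma 8.3** (first mollified moment, individual even `k`, `M = k^Δ`, `0 < Δ < 1 − ε`):
`M₁ := Σ^h_{f ∈ H_{2k}(1)} M(f) L_f(1/2) = 4ζ(2)/log M + O((log M)^{−2})` for `k ≥ k₀`. Status:
theorem-in-print (named fact). [cite: BalkanovaFrolenkov2021, Lemma 8.3] -/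
def balkanovaFrolenkov2021_lemma83 : Prop :=
  ∀ ε Δ : ℝ, 0 < ε → 0 < Δ → Δ < 1 - ε →
    ∃ k₀ : ℕ, ∃ C : ℝ, ∀ k : ℕ, k₀ ≤ k → Even k →
      ‖harmonicSum (2 * (k : ℤ)) (fun f => mollifierValue ((k : ℝ) ^ Δ) f * centralValue f) -
          ((4 * zetaTwo / Real.log ((k : ℝ) ^ Δ) : ℝ) : ℂ)‖ ≤
        C * (Real.log ((k : ℝ) ^ Δ))⁻¹ ^ 2

/-- **Lemma 8.4** (first mollified moment on average over `4k ≍ K`, `M = K^Δ`, `0 < Δ < 1 − ε`):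
`A₁ := Σ_k h(4k/K) Σ^h_{f ∈ H_{4k}(1)} M(f) L_f(1/2) = (HK/4)·(4ζ(2)/log M) + O(K (log M)^{−2})` for
`K ≥ K₀`. Status: theorem-in-print (named fact). [cite: BalkanovaFrolenkov2021, Lemma 8.4] -/
def balkanovaFrolenkov2021_lemma84 : Prop :=
  ∀ h : ℝ → ℝ, IsWeightTest h → ∀ ε Δ : ℝ, 0 < ε → 0 < Δ → Δ < 1 - ε →
    ∃ K₀ C : ℝ, ∀ K : ℝ, K₀ ≤ K →
      ‖weightAverage h K (fun k =>
            harmonicSum (4 * (k : ℤ)) (fun f => mollifierValue (K ^ Δ) f * centralValue f)) -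
          ((weightMass h * K / 4 * (4 * zetaTwo / Real.log (K ^ Δ)) : ℝ) : ℂ)‖ ≤
        C * K * (Real.log (K ^ Δ))⁻¹ ^ 2

/-- **Lemma 8.5** (second mollified moment, individual even `k`, `M = k^Δ`, `0 < Δ < 1/4 − ε`):
`M₂ := Σ^h_{f ∈ H_{2k}(1)} M²(f) L_f²(1/2) = (16ζ²(2)/(log M)²)(1 + 1/Δ) + O((log M)^{−3})` for
`k ≥ k₀`. (The range `Δ < 1/4` is "the largest admissible length of mollifier" for a single weight.)
Status: theorem-in-print (named fact). [cite: BalkanovaFrolenkov2021, Lemma 8.5] -/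
def balkanovaFrolenkov2021_lemma85 : Prop :=
  ∀ ε Δ : ℝ, 0 < ε → 0 < Δ → Δ < 1 / 4 - ε →
    ∃ k₀ : ℕ, ∃ C : ℝ, ∀ k : ℕ, k₀ ≤ k → Even k →
      ‖harmonicSum (2 * (k : ℤ))
            (fun f => mollifierValue ((k : ℝ) ^ Δ) f ^ 2 * centralValue f ^ 2) -
          ((16 * zetaTwo ^ 2 / Real.log ((k : ℝ) ^ Δ) ^ 2 * (1 + 1 / Δ) : ℝ) : ℂ)‖ ≤
        C * (Real.log ((k : ℝ) ^ Δ))⁻¹ ^ 3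

/-- **Lemma 8.6** (second mollified moment on average over `4k ≍ K`, `M = K^Δ`, `0 < Δ < 1 − ε`):
`A₂ := Σ_k h(4k/K) Σ^h_{f ∈ H_{4k}(1)} M²(f) L_f²(1/2) = (HK/4)(16ζ²(2)/(log M)²)(1 + 1/Δ) + O(K (log M)^{−3})`
for `K ≥ K₀`. (On average the admissible length is `Δ < 1`, four times the individual range.)
Status: theorem-in-print (named fact). [cite: BalkanovaFrolenkov2021, Lemma 8.6] -/
def balkanovaFrolenkov2021_lemma86 : Prop :=
  ∀ h : ℝ → ℝ, IsWeightTest h → ∀ ε Δ : ℝ, 0 < ε → 0 < Δ → Δ < 1 - ε →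
    ∃ K₀ C : ℝ, ∀ K : ℝ, K₀ ≤ K →
      ‖weightAverage h K (fun k =>
            harmonicSum (4 * (k : ℤ))
              (fun f => mollifierValue (K ^ Δ) f ^ 2 * centralValue f ^ 2)) -
          ((weightMass h * K / 4 * (16 * zetaTwo ^ 2 / Real.log (K ^ Δ) ^ 2 * (1 + 1 / Δ)) :
              ℝ) : ℂ)‖ ≤
        C * K * (Real.log (K ^ Δ))⁻¹ ^ 3

/-- **Theorem 8.7** (harmonic weights, individual weight). For any `ε > 0` there exists `k₀ = k₀(ε)`
such that for any even `k ≥ k₀`: `Σ^h_{f ∈ H_{2k}(1), L_f(1/2) ≥ (log k)^{−2}} 1 ≥ 1/5 − ε` (the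
harmonic sum of the indicator, i.e. `Σ_{f ∈ H_{2k}(1), L_f(1/2) ≥ (log k)^{−2}} ω_f`). Status:
theorem-in-print (named fact). [cite: BalkanovaFrolenkov2021, Theorem 8.7] -/
def balkanovaFrolenkov2021_theorem87 : Prop :=
  ∀ ε : ℝ, 0 < ε → ∃ k₀ : ℕ, ∀ k : ℕ, k₀ ≤ k → Even k →
    1 / 5 - ε ≤ ∑ᶠ f ∈ largeValueForms (2 * (k : ℤ)) (1 / Real.log k ^ 2), harmonicWeight f

/-- **ERRATUM (2026-08-27, cell `landau-siegel` §C, T-023; read against arXiv:1610.03465 v3, TeX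
l. 2282–2290 = held chunks p0021:L59–L66 (Theorem 8.8) and §7 (7.1)–(7.2), p0017:L3–L13): FALSE AS
TYPED — kernel-refuted, `not_balkanovaFrolenkov2021_theorem88`
(`LevelOneCentralValuesWeightAspectRefutation.lean`, witness found by the §C reader seat ls-lit-r7);
use the primed decl `balkanovaFrolenkov2021_theorem88'`.** The binder `IsWeightTest h` admits `h ≡ 0`
(`tsupport 0 = ∅ ⊆ [θ₁, θ₂]`, `0 ≤ 0`), for which `weightMass h = H = 0`, Lean's `4/(0·K) = 0`, and the
display below reads `1/2 − ε ≤ 0`: false at `ε = 1/4`. The source divides by `H` (`4/(HK)` in the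
display of Theorem 8.8; `H₁/H` in Lemma 7.1), i.e. it uses `H = ∫₀^∞ h > 0` — a non-negative test
function that is not identically zero — without saying so; the faithful rendering makes that printed
implicit hypothesis the explicit binder `0 < weightMass h` and changes nothing else
(`balkanovaFrolenkov2021_theorem88'`, next declaration). This declaration's body is kept byte-identical
(misstatement protocol: never edit a landed fact's meaning in place); nothing may be discharged from it.

**Theorem 8.8** (harmonic weights, smooth average over the weights `4k ≍ K`). For every §7 test
function `h` and any `ε > 0` there is `K₀ = K₀(ε, h)` such that for any `K ≥ K₀`:
`(4/(HK)) Σ_k h(4k/K) Σ^h_{f ∈ H_{4k}(1), L_f(1/2) ≥ (log k)^{−2}} 1 ≥ 1/2 − ε` (`H = ∫ h`). This is the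
weight-aspect `1/2` of the third knife edge, reached with mollifier length `K^Δ` for every `Δ < 1`
(`Δ/(1+Δ) → 1/2`). Status: theorem-in-print (named fact). [cite: BalkanovaFrolenkov2021, Theorem 8.8] -/
def balkanovaFrolenkov2021_theorem88 : Prop :=
  ∀ h : ℝ → ℝ, IsWeightTest h → ∀ ε : ℝ, 0 < ε → ∃ K₀ : ℝ, ∀ K : ℝ, K₀ ≤ K →
    1 / 2 - ε ≤ 4 / (weightMass h * K) *
      ∑ᶠ k : ℕ, h (4 * (k : ℝ) / K) *
        ∑ᶠ f ∈ largeValueForms (4 * (k : ℤ)) (1 / Real.log k ^ 2), harmonicWeight f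

/-- **Theorem 8.8, faithful rendering (supersedes `balkanovaFrolenkov2021_theorem88`, see the ERRATUM
there)** (harmonic weights, smooth average over the weights `4k ≍ K`). For every §7 test function `h`
— `h ∈ C₀^∞(ℝ⁺)` non-negative, compactly supported in `[θ₁, θ₂]`, `0 < θ₁ < θ₂` ((7.1)) — with
`H := ∫₀^∞ h(y) dy > 0` ((7.2); the source divides by `H`, so `h ≢ 0` is its standing implicit
hypothesis, here the explicit binder `0 < weightMass h`), and any `ε > 0`, there is `K₀ = K₀(ε, h)`
such that for any `K ≥ K₀`:
`(4/(HK)) Σ_k h(4k/K) Σ^h_{f ∈ H_{4k}(1), L_f(1/2) ≥ (log k)^{−2}} 1 ≥ 1/2 − ε`.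
The display is the old one byte-for-byte with the single new binder `0 < weightMass h` inserted right
after `IsWeightTest h` (same `∑ᶠ`, same `largeValueForms (4k)`, same `harmonicWeight`, same
`4/(weightMass h · K)`). This is the weight-aspect `1/2` of the third knife edge, reached with mollifier
length `K^Δ` for every `Δ < 1` (`Δ/(1+Δ) → 1/2`; proof p0021:L68–L92: Cauchy–Schwarz twice, Lemmas 8.2,
8.4, 8.6, `≥ ((4/(HK))A₁ − (4/(HK))Ã₁)²/((4/(HK))A₂) ≥ Δ/(1+Δ)` for any `Δ < 1 − ε`). Status:
theorem-in-print (named fact).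
[cite: BalkanovaFrolenkov2021, Theorem 8.8 (arXiv v3 TeX l. 2282–2290; held p0021:L59–L66) with §7 (7.1)–(7.2) (p0017:L3–L13, `H := ∫₀^∞ h(y)dy`)] -/
def balkanovaFrolenkov2021_theorem88' : Prop :=
  ∀ h : ℝ → ℝ, IsWeightTest h → 0 < weightMass h → ∀ ε : ℝ, 0 < ε → ∃ K₀ : ℝ, ∀ K : ℝ, K₀ ≤ K →
    1 / 2 - ε ≤ 4 / (weightMass h * K) *
      ∑ᶠ k : ℕ, h (4 * (k : ℝ) / K) *
        ∑ᶠ f ∈ largeValueForms (4 * (k : ℤ)) (1 / Real.log k ^ 2), harmonicWeight f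

/-- The faithful rendering is implied by the old one (trivially: it has one more hypothesis) — recorded
only so that the direction of the correction is kernel-visible; the converse fails
(`not_balkanovaFrolenkov2021_theorem88`). [cite: BalkanovaFrolenkov2021, Theorem 8.8] -/
theorem balkanovaFrolenkov2021_theorem88'_of_theorem88 (h88 : balkanovaFrolenkov2021_theorem88) :
    balkanovaFrolenkov2021_theorem88' :=
  fun h hh _ ε hε => h88 h hh ε hε

/-! ### Bookkeeping (proved) -/

/-- `x_m = 0` beyond the mollifier length. [cite: BalkanovaFrolenkov2021, §8.1 (8.1)–(8.2)] -/
theorem mollifierCoeff_eq_zero_of_lt {M : ℝ} {m : ℕ} (h : M < m) : mollifierCoeff M m = 0 := by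
  unfold mollifierCoeff
  rw [if_neg]
  rintro ⟨_, hle⟩
  exact absurd hle (not_le.mpr h)

/-- The proportion `Δ/(1+Δ)` of the proofs of Theorems 8.7/8.8 equals `1/5` at the individual edge
`Δ = 1/4` and tends to `1/2` at the averaged edge `Δ = 1` (here: equals `1/2` at `Δ = 1`).
[cite: BalkanovaFrolenkov2021, proofs of Theorems 8.7 and 8.8 (Δ/(1+Δ))] -/
theorem proportion_at_edges :
    (1 / 4 : ℝ) / (1 + 1 / 4) = 1 / 5 ∧ (1 : ℝ) / (1 + 1) = 1 / 2 := by
  norm_num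

/-- `Δ ↦ Δ/(1+Δ)` is strictly below `1/2` for every `0 < Δ < 1`: no admissible mollifier length of
Theorem 8.8 (`Δ < 1`) yields a proportion `> 1/2` by this Cauchy–Schwarz route — the printed locus of the
edge. [cite: BalkanovaFrolenkov2021, proof of Theorem 8.8 ("for any Δ < 1 − ε")] -/
theorem proportion_lt_half {Δ : ℝ} (h0 : 0 < Δ) (h1 : Δ < 1) : Δ / (1 + Δ) < 1 / 2 := by
  rw [div_lt_div_iff₀ (by linarith) (by norm_num)]
  linarith

end LevelOneCentralValues

end Literature.NumberTheory.LFunctions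

end
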